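import Summits.ABC.StewartYu.DescentIntegralityQ
import Summits.ABC.StewartYu.PadicMultiquadraticLiouvilleSharp
import Literature.NumberTheory.Transcendental.Waldschmidt1980KStep
import HarnessLib

/-!
# Cell abc-stewartyu, WP-A3 (vii): where the `p`-adic Liouville inequalities meet the descent

`Summits/ABC/StewartYu/DescentLiouvilleQ.lean` — cell `abc-stewartyu` (HOME
`run/shared/lean/pub/abc-stewartyu/`, seat p3; work package WP-A3 of `HOME/p2/PADIC-CORE.md`,
rows "W80KStep `coreSum_eq_zero_of_abs_lt`" and "CW77Steps `classVec_eq_zero`" of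
`HOME/plan/PORT-MAP.md`; theorems only, no named fact), sequel to `DescentIntegralityQ.lean` and
`PadicMultiquadraticLiouvilleSharp.lean`.

The two places where the `p`-adic analytic estimates (smallness of the auxiliary function at the
integer points `s` and at the half points `s/2`, WP-A1/WP-A2/WP-A5) are converted into the EXACT
relations consumed by the algebra of the descent (`SetupQ.Inv.rel`, `SetupQ.descent_algebra`):

* `exists_int_DclearJ_mul_qTerm`, `exists_int_DclearJ_mul_coreSum` — the signed rational core
  `coreSum_{J,τ}(s)` has denominator dividing `D_J(s,τ) = Q.flat.DclearJ …` (the tree's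
  `CW77.Setup.exists_int_DclearJ_mul_qTerm` [cite: Waldschmidt1980, Lemma 3.4 (p. 269)], signs
  allowed);
* `padicNorm_ge_of_int_mul` — **the product formula for one rational**: `x ≠ 0`, `D x ∈ ℤ`,
  `|x| ≤ M` ⟹ `‖x‖_p ≥ 1/(D M)`; hence `coreSum_eq_zero_of_padicNorm_lt` — the `p`-adic twin of
  `CW77.Setup.coreSum_eq_zero_of_abs_lt` ((3.21) of Waldschmidt 1980): `‖coreSum‖_p < 1/(Dmax·Mmax)`,
  `D_J ≤ Dmax`, `|coreSum| ≤ Mmax` ⟹ `coreSum = 0`;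
* `classVec_eq_zero_of_padicNorm_lt` — **the `p`-adic twin of `CW77.Setup.classVec_eq_zero`**:
  under the `2`-Kummer condition on the SIGNED generators and with `p`-adic roots `rᵢ² = allᵢ`,
  `‖rᵢ‖_p ≤ 1`, if `‖evL r (classVec_{J,τ,s})‖_p` is below the sharp Liouville bound
  `D/(4D²M(∏H(allᵢ))³)^{2^{d+1}}` (`D = Dhalf♭`, `M ≥ ∑|classVec|`) then ALL class sums vanish —
  exactly the hypothesis `half` of `SetupQ.descent_algebra`.

Everything is [folklore].
-/

noncomputable section

open Finset
open Literature.NumberTheory.Transcendental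
open Literature.NumberTheory.Transcendental.Baker1975.Ch3 (nuBound nuBound_pos)
open Literature.NumberTheory.Transcendental.CW77
open Literature.NumberTheory.Transcendental.CW77.Setup (Idx Tau tauNorm scale)

namespace Summit.ABC.StewartYu

namespace SetupQ

variable (Q : SetupQ) {h Lb : ℕ}

/-! ### Denominators of the signed core at the integer points of level `J` -/

/-- The denominator part of `DclearJ♭` is that of the signed generators. [folklore] -/
theorem flat_DclearJ_eq (J₀ J : ℕ) (L : Fin Q.d → ℕ) (Lθ : ℕ) (s : ℕ) (τ : Tau Q.d) :
    Q.flat.DclearJ (h := h) J₀ J L Lθ s τ =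
      nuBound (scale J₀ J * s) h ^ τ.1 * Q.bθ.natAbs ^ (∑ j, τ.2 j) *
        ((∏ j, (Q.α j).den ^ (L j / 2 ^ J * s)) * Q.θ.den ^ (Lθ / 2 ^ J * s)) := by
  unfold CW77.Setup.DclearJ
  simp only [Rat.den_abs_eq_den]

/-- **`D_J(s,τ) · qTerm_J(u,τ,s) ∈ ℤ` on the box of level `J`** (signed). [folklore] -/
theorem exists_int_DclearJ_mul_qTerm (J₀ J : ℕ) {L : Fin Q.d → ℕ} {Lθ : ℕ} {u : Idx Q.d h Lb}
    (hu : u ∈ Q.flat.box (h := h) (Lb := Lb) L Lθ J) (τ : Tau Q.d) (s : ℕ) :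
    ∃ z : ℤ, ((Q.flat.DclearJ (h := h) J₀ J L Lθ s τ : ℕ) : ℚ) * Q.qTerm J₀ J u τ s = z := by
  rw [Q.flat.mem_box] at hu
  obtain ⟨z₁, hz₁⟩ := Q.flat.exists_int_qΔ J₀ J u τ.1 s
  obtain ⟨z₂, hz₂⟩ := Q.flat.exists_int_qA u τ.2
  obtain ⟨z₃, hz₃⟩ := Q.exists_int_qE (L := fun j => L j / 2 ^ J) (Lθ := Lθ / 2 ^ J) hu s
  refine ⟨z₁ * z₂ * z₃, ?_⟩
  rw [Q.flat_DclearJ_eq]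
  unfold qTerm
  push_cast at hz₁ hz₂ hz₃ ⊢
  rw [← hz₁, ← hz₂, ← hz₃]; ring

/-- `D_J(s,τ) · coreSum_{J,τ}(s) ∈ ℤ` for `p` supported in the box of level `J`. [folklore] -/
theorem exists_int_DclearJ_mul_coreSum (J₀ J : ℕ) (L : Fin Q.d → ℕ) (Lθ : ℕ) (p : Idx Q.d h Lb → ℤ)
    (τ : Tau Q.d) (s : ℕ) :
    ∃ z : ℤ, ((Q.flat.DclearJ (h := h) J₀ J L Lθ s τ : ℕ) : ℚ) *
      Q.coreSum J₀ J (Q.flat.box (h := h) (Lb := Lb) L Lθ J) p τ s = z := by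
  classical
  unfold coreSum
  rw [mul_sum]
  have hterm : ∀ u ∈ Q.flat.box (h := h) (Lb := Lb) L Lθ J, ∃ z : ℤ,
      ((Q.flat.DclearJ (h := h) J₀ J L Lθ s τ : ℕ) : ℚ) * ((p u : ℚ) * Q.qTerm J₀ J u τ s) = z := by
    intro u hu
    obtain ⟨z, hz⟩ := Q.exists_int_DclearJ_mul_qTerm J₀ J hu τ s
    exact ⟨p u * z, by push_cast; rw [← hz]; ring⟩
  choose z hz using hterm
  refine ⟨∑ u ∈ (Q.flat.box (h := h) (Lb := Lb) L Lθ J).attach, z u.1 u.2, ?_⟩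
  push_cast
  rw [← sum_attach]
  exact sum_congr rfl fun u _ => hz u.1 u.2

/-! ### The product formula at the integer points -/

section Padic

variable {p : ℕ} [Fact p.Prime]

/-- **The product formula for one rational number**: if `x ≠ 0`, `D x ∈ ℤ` (`D ≥ 1`) and `|x| ≤ M`,
then `‖x‖_p ≥ 1/(D M)` (`‖z/D‖_p ≥ ‖z‖_p ≥ 1/|z| ≥ 1/(DM)`). [folklore] -/
theorem padicNorm_ge_of_int_mul {x : ℚ} (hx : x ≠ 0) {D : ℕ} (hD : 1 ≤ D)
    (hint : ∃ z : ℤ, (D : ℚ) * x = z) {M : ℝ} (hM : |(x : ℝ)| ≤ M) :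
    1 / ((D : ℝ) * M) ≤ ‖(x : ℚ_[p])‖ := by
  obtain ⟨z, hz⟩ := hint
  have hD0 : (D : ℚ) ≠ 0 := by exact_mod_cast (show D ≠ 0 by omega)
  have hz0 : z ≠ 0 := by
    rintro rfl
    rw [Int.cast_zero, mul_eq_zero] at hz
    exact hz.elim hD0 hx
  have hxz : x = (z : ℚ) / D := by field_simp; rw [mul_comm]; exact hz
  have hDR : (0 : ℝ) < D := by exact_mod_cast (show 0 < D by omega)
  have hzle : |(z : ℝ)| ≤ D * M := by
    have h1 : ((x : ℚ) : ℝ) = (z : ℝ) / D := by rw [hxz]; push_cast; rfl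
    rw [h1, abs_div, abs_of_pos hDR, div_le_iff₀ hDR] at hM
    linarith
  have hzabs : (0 : ℝ) < |(z : ℝ)| := abs_pos.mpr (by exact_mod_cast hz0)
  have hnormD : ‖(D : ℚ_[p])‖ ≤ 1 := by simpa using Padic.norm_int_le_one (p := p) (D : ℤ)
  have hnormD0 : 0 < ‖(D : ℚ_[p])‖ := norm_pos_iff.mpr (Nat.cast_ne_zero.mpr (by omega))
  calc 1 / ((D : ℝ) * M) ≤ 1 / |(z : ℝ)| := one_div_le_one_div_of_le hzabs hzle
    _ ≤ ‖((z : ℤ) : ℚ_[p])‖ := Multiquad.inv_abs_le_norm_intCast hz0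
    _ ≤ ‖((z : ℤ) : ℚ_[p])‖ / ‖(D : ℚ_[p])‖ := by
        rw [le_div_iff₀ hnormD0]
        exact mul_le_of_le_one_right (norm_nonneg _) hnormD
    _ = ‖(x : ℚ_[p])‖ := by rw [hxz, Rat.cast_div, Rat.cast_intCast, Rat.cast_natCast, norm_div]

/-- **The `p`-adic Liouville estimate at the integer points** (twin of (3.21) of Waldschmidt 1980,
`CW77.Setup.coreSum_eq_zero_of_abs_lt`): if `D_J(s,τ) ≤ Dmax`, `|coreSum_{J,τ}(s)| ≤ Mmax` and
`‖coreSum_{J,τ}(s)‖_p < 1/(Dmax · Mmax)`, then `coreSum_{J,τ}(s) = 0`. [folklore] -/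
theorem coreSum_eq_zero_of_padicNorm_lt (J₀ J : ℕ) (L : Fin Q.d → ℕ) (Lθ : ℕ) (pv : Idx Q.d h Lb → ℤ)
    (τ : Tau Q.d) (s : ℕ) {Dmax Mmax : ℝ}
    (hD : ((Q.flat.DclearJ (h := h) J₀ J L Lθ s τ : ℕ) : ℝ) ≤ Dmax) (hMmax : 0 < Mmax)
    (hM : |(Q.coreSum J₀ J (Q.flat.box (h := h) (Lb := Lb) L Lθ J) pv τ s : ℝ)| ≤ Mmax)
    (hlt : ‖((Q.coreSum J₀ J (Q.flat.box (h := h) (Lb := Lb) L Lθ J) pv τ s : ℚ) : ℚ_[p])‖ <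
      1 / (Dmax * Mmax)) :
    Q.coreSum J₀ J (Q.flat.box (h := h) (Lb := Lb) L Lθ J) pv τ s = 0 := by
  by_contra hne
  set D : ℕ := Q.flat.DclearJ (h := h) J₀ J L Lθ s τ with hDdef
  have hD1 : 1 ≤ D := Q.flat.DclearJ_pos J₀ J L Lθ s τ
  have hge := padicNorm_ge_of_int_mul (p := p) hne hD1 (Q.exists_int_DclearJ_mul_coreSum J₀ J L Lθ pv τ s) hM
  have hDR : (0 : ℝ) < D := by exact_mod_cast (show 0 < D by omega)
  have hmono : 1 / (Dmax * Mmax) ≤ 1 / ((D : ℝ) * Mmax) :=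
    one_div_le_one_div_of_le (by positivity) (mul_le_mul_of_nonneg_right hD hMmax.le)
  exact absurd (hmono.trans hge) (not_le.mpr hlt)

/-! ### The Liouville inequality at the half points: vanishing of the class sums -/

/-- **The `p`-adic twin of `CW77.Setup.classVec_eq_zero`.** Let the signed generators `allᵢ` satisfy
the `2`-Kummer condition and have `p`-adic square roots `rᵢ` (`rᵢ² = allᵢ`, `‖rᵢ‖_p ≤ 1`). If the
evaluation `evL r (classVec_{J,τ,s})` of the class-sum vector (denominator `Dhalf♭ ≥ 1`,
`∑_{T'} |classVec(T')| ≤ M`, `M ≥ 1`) is `p`-adically smaller than the sharp Liouville bound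
`Dhalf♭/(4 Dhalf♭² M (∏ᵢ H(allᵢ))³)^{2^{d+1}}`, then every class sum vanishes. [folklore] -/
theorem classVec_eq_zero_of_padicNorm_lt
    (hind : ∀ T' : Finset (Fin (Q.d + 1)), T'.Nonempty → ¬ IsSquare (∏ i ∈ T', Q.all i))
    (r : Fin (Q.d + 1) → ℚ_[p]) (hr : ∀ i, r i * r i = (Q.all i : ℚ_[p])) (hr1 : ∀ i, ‖r i‖ ≤ 1)
    (J₀ J : ℕ) (L : Fin Q.d → ℕ) (Lθ : ℕ) (pv : Idx Q.d h Lb → ℤ) (τ : Tau Q.d) (s : ℕ)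
    {M : ℝ} (hM : 1 ≤ M)
    (hcM : ∑ T', |(Q.classVec J₀ J (Q.flat.box (h := h) (Lb := Lb) L Lθ J) pv τ s T' : ℝ)| ≤ M)
    (hlt : ‖Multiquad.evL r (Q.classVec J₀ J (Q.flat.box (h := h) (Lb := Lb) L Lθ J) pv τ s)‖ <
      (Q.flat.Dhalf (h := h) J₀ J L Lθ s τ : ℝ) /
        (4 * (Q.flat.Dhalf (h := h) J₀ J L Lθ s τ : ℝ) ^ 2 * M * heightProd Q.all ^ 3) ^ (2 ^ (Q.d + 1))) :
    Q.classVec J₀ J (Q.flat.box (h := h) (Lb := Lb) L Lθ J) pv τ s = 0 := by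
  by_contra hne
  have hD1 : 1 ≤ Q.flat.Dhalf (h := h) J₀ J L Lθ s τ := Q.flat.Dhalf_pos J₀ J L Lθ s τ
  have hge := Multiquad.norm_evL_ge_sharp (p := p) (Q.d + 1) Q.all hind r hr hr1 _ hne
    (Q.flat.Dhalf (h := h) J₀ J L Lθ s τ) hD1
    (fun T' => Q.exists_int_Dhalf_mul_classVec J₀ J L Lθ τ s T') M hM hcM
  exact absurd hge (not_le.mpr hlt)

end Padic

end SetupQ

end Summit.ABC.StewartYu

end
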